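import Mathlib
import Summits.ValiantsHypothesis.ValiantsHypothesis.Theorems.GrenetZeonHessianRankCodimTwoLatinAssembly
import Summits.ValiantsHypothesis.ValiantsHypothesis.Theorems.GrenetZeonHessianRankCodimTwoBorderDefs
import HarnessLib

/-!
# Crux `GrenetZeon.HessianRankCodimTwo` (stmt-ValiantsHypothesis-8061), line `good_plane`, ALL large `n`:
# the characteristic-`p` DEATH COUNT — at most four of the nine core block values die

Seat val-width-8061-p3 g2, file `…BorderDeaths` of the plan `Cruxes/HessianRankCodimTwo/BorderedLatinAllN.md` §3/§5
(lead val-width-8061-p1 g2), with the interface fixed in `Cruxes/HessianRankCodimTwo/BorderInterfaces.md` §2.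

Setting: a field `K` (a field of characteristic `p`, `p` a large prime, in the assembly), a point `x ≠ 0` of
the curve `F(x)·W(x)^r = 0` of the bordered Latin plane reduced mod `p` (`F = x₀³+x₁³+x₂³+3x₀x₁x₂` the Latin
cubic, `W = w(x)` the corner form), and `c = r + 1 ≠ 0`.  By the congruences of `…BorderFrobeniusCongr/Eval`
(`dead_of_aeval_bordPsi_eq_zero`) the core block value `(I, J)`, `d = J - I`, dies mod `p` only if
  `DEAD(I,J)`:  `classDead d` (`x_d = 0 ∨ P_d(x) = 0`)  ∨  `x_d W = U_I V_J`  ∨  `x_d W = c · U_I V_J`,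
with the border column / row forms `U_I = u_I(x)`, `V_J = v_J(x)`.  THIS FILE: `#{(I,J) : DEAD(I,J)} ≤ 4`, from
FIELD-LEVEL non-degeneracy hypotheses on the design (proved for the concrete design by Bézout certificates in
the lead's `…BorderCert*` files, for `char K = 0` or `≥ 3·10¹⁴`), namely (BorderInterfaces.md §1)

* (HW) on the line `W = 0` the nine events `classDead d`, `U_I = 0`, `V_J = 0` are pairwise exclusive;
* (HC) at a class-death point of `F = 0` (`classDead d₀`) every pair off class `d₀` has `x_d W ≠ U_I V_J`, and the
  ratios `μ_P = x_d W/(U_I V_J)` of two distinct such pairs are distinct;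
* (HT) on `F = 0`, off the line and with all classes alive, no three distinct pairs share a ratio `μ`;

together with the landed `latin_elim` (`…LatinAssembly`: on `F = 0`, two distinct dead classes force `x = 0`,
`char ≠ 2`).  Count (memo §3): (A) `W = 0`: a dead pair has `classDead d ∨ U_I = 0 ∨ V_J = 0`; by (HW) one
event at most, killing one class / row / column: `≤ 3`.  (B) `W ≠ 0`, `F = 0`: (B-i) a class `d₀` is dead — the
other classes are alive (`latin_elim`), a dead pair off class `d₀` has `U_I V_J ≠ 0` and `μ ∈ {1, c}`, (HC) excludes
`μ = 1` and makes the `μ` distinct, so at most one more pair dies: `≤ 3 + 1`; (B-ii) no class dead — dead pairs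
have `μ ∈ {1, c}` and (HT) bounds each value class by `2`: `≤ 2 + 2`.

* `deaths_le_four_of_hyp` — the count for abstract data `x, U, V : Fin 3 → K`, `W c : K`;
* `bord_deaths_le_four` — the interface shape of BorderInterfaces.md §2 (the forms written literally as
  `aeval x (bordEnt ℤ _ _)`, hypotheses = the §1 statements universally quantified over the point).

VP ≠ VNP is not moved by anything here (the crux feeds only the constant-factor bound `TwoDimCoefficients`).
-/

noncomputable section

open MvPolynomial Finset

-- single-conjunct layout `Summits/ValiantsHypothesis/ValiantsHypothesis`: duplicated namespace by design
set_option linter.dupNamespace false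

namespace Summit.ValiantsHypothesis.ValiantsHypothesis.Theorems.GrenetZeonHessianRankCodimTwo

section Count

variable {K : Type*} [Field K] [DecidableEq K]

/-! ### Small counting facts on `Fin 3 × Fin 3` -/

/-- A class `{(I, J) : J - I = d}` has three pairs. [folklore] -/
theorem card_filter_sub_eq (d : Fin 3) :
    #(univ.filter fun IJ : Fin 3 × Fin 3 => IJ.2 - IJ.1 = d) = 3 := by
  revert d; decide

/-- A row `{(I₀, J)}` has three pairs. [folklore] -/
theorem card_filter_fst_eq (I₀ : Fin 3) :
    #(univ.filter fun IJ : Fin 3 × Fin 3 => IJ.1 = I₀) = 3 := by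
  revert I₀; decide

/-- A column `{(I, J₀)}` has three pairs. [folklore] -/
theorem card_filter_snd_eq (J₀ : Fin 3) :
    #(univ.filter fun IJ : Fin 3 × Fin 3 => IJ.2 = J₀) = 3 := by
  revert J₀; decide

/-! ### The abstract count -/

/-- **At most four deaths (abstract form).**  For `x, U, V : Fin 3 → K`, `W c : K` with `c ≠ 0`, `2 ≠ 0`,
`x ≠ 0` on the curve `F(x) = 0 ∨ W = 0`, under the hypotheses (HW), (HC), (HT) of the file header (at this
point), at most four of the nine pairs `(I, J)` satisfy
`classDead (J-I) ∨ x_{J-I} W = U_I V_J ∨ x_{J-I} W = c U_I V_J`. [folklore] -/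
theorem deaths_le_four_of_hyp (x U V : Fin 3 → K) (W c : K) (hc : c ≠ 0) (h2 : (2 : K) ≠ 0)
    (hx : x ≠ 0)
    (hcurve : x 0 ^ 3 + x 1 ^ 3 + x 2 ^ 3 + 3 * (x 0 * x 1 * x 2) = 0 ∨ W = 0)
    (HW₁ : W = 0 → ∀ {d d' : Fin 3},
      (x d = 0 ∨ x d ^ 2 + x (d + 1) * x (d + 2) = 0) →
      (x d' = 0 ∨ x d' ^ 2 + x (d' + 1) * x (d' + 2) = 0) → d = d')
    (HW₂ : W = 0 → ∀ {d I : Fin 3},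
      (x d = 0 ∨ x d ^ 2 + x (d + 1) * x (d + 2) = 0) → U I = 0 → False)
    (HW₃ : W = 0 → ∀ {d J : Fin 3},
      (x d = 0 ∨ x d ^ 2 + x (d + 1) * x (d + 2) = 0) → V J = 0 → False)
    (HW₄ : W = 0 → ∀ {I I' : Fin 3}, U I = 0 → U I' = 0 → I = I')
    (HW₅ : W = 0 → ∀ {J J' : Fin 3}, V J = 0 → V J' = 0 → J = J')
    (HW₆ : W = 0 → ∀ {I J : Fin 3}, U I = 0 → V J = 0 → False)
    (HCQ : x 0 ^ 3 + x 1 ^ 3 + x 2 ^ 3 + 3 * (x 0 * x 1 * x 2) = 0 → ∀ {d₀ : Fin 3},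
      (x d₀ = 0 ∨ x d₀ ^ 2 + x (d₀ + 1) * x (d₀ + 2) = 0) → ∀ {I J : Fin 3}, J - I ≠ d₀ →
      x (J - I) * W ≠ U I * V J)
    (HCE : x 0 ^ 3 + x 1 ^ 3 + x 2 ^ 3 + 3 * (x 0 * x 1 * x 2) = 0 → ∀ {d₀ : Fin 3},
      (x d₀ = 0 ∨ x d₀ ^ 2 + x (d₀ + 1) * x (d₀ + 2) = 0) → ∀ {I J I' J' : Fin 3},
      J - I ≠ d₀ → J' - I' ≠ d₀ → (I, J) ≠ (I', J') → U I * V J ≠ 0 → U I' * V J' ≠ 0 →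
      x (J - I) ≠ 0 → x (J' - I') ≠ 0 → x (J - I) * (U I' * V J') ≠ x (J' - I') * (U I * V J))
    (HT : x 0 ^ 3 + x 1 ^ 3 + x 2 ^ 3 + 3 * (x 0 * x 1 * x 2) = 0 → W ≠ 0 → (∀ d, x d ≠ 0) →
      ∀ {I₁ J₁ I₂ J₂ I₃ J₃ : Fin 3}, (I₁, J₁) ≠ (I₂, J₂) → (I₁, J₁) ≠ (I₃, J₃) → (I₂, J₂) ≠ (I₃, J₃) →
      U I₁ * V J₁ ≠ 0 → U I₂ * V J₂ ≠ 0 → U I₃ * V J₃ ≠ 0 →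
      x (J₁ - I₁) * (U I₂ * V J₂) = x (J₂ - I₂) * (U I₁ * V J₁) →
      x (J₁ - I₁) * (U I₃ * V J₃) = x (J₃ - I₃) * (U I₁ * V J₁) → False) :
    #(univ.filter fun IJ : Fin 3 × Fin 3 =>
        (x (IJ.2 - IJ.1) = 0 ∨ x (IJ.2 - IJ.1) ^ 2 + x (IJ.2 - IJ.1 + 1) * x (IJ.2 - IJ.1 + 2) = 0) ∨
        x (IJ.2 - IJ.1) * W = U IJ.1 * V IJ.2 ∨
        x (IJ.2 - IJ.1) * W = c * (U IJ.1 * V IJ.2)) ≤ 4 := by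
  set Dead := univ.filter fun IJ : Fin 3 × Fin 3 =>
        (x (IJ.2 - IJ.1) = 0 ∨ x (IJ.2 - IJ.1) ^ 2 + x (IJ.2 - IJ.1 + 1) * x (IJ.2 - IJ.1 + 2) = 0) ∨
        x (IJ.2 - IJ.1) * W = U IJ.1 * V IJ.2 ∨
        x (IJ.2 - IJ.1) * W = c * (U IJ.1 * V IJ.2) with hDead
  have memDead : ∀ IJ : Fin 3 × Fin 3, IJ ∈ Dead ↔
      ((x (IJ.2 - IJ.1) = 0 ∨ x (IJ.2 - IJ.1) ^ 2 + x (IJ.2 - IJ.1 + 1) * x (IJ.2 - IJ.1 + 2) = 0) ∨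
        x (IJ.2 - IJ.1) * W = U IJ.1 * V IJ.2 ∨
        x (IJ.2 - IJ.1) * W = c * (U IJ.1 * V IJ.2)) := fun IJ => by
    rw [hDead, Finset.mem_filter]
    simp only [Finset.mem_univ, true_and]
  rcases eq_or_ne W 0 with hW | hW
  · /- (A) the line `W = 0`: a dead pair has a dead class, a zero column form or a zero row form -/
    have key : ∀ IJ ∈ Dead,
        (x (IJ.2 - IJ.1) = 0 ∨ x (IJ.2 - IJ.1) ^ 2 + x (IJ.2 - IJ.1 + 1) * x (IJ.2 - IJ.1 + 2) = 0) ∨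
          U IJ.1 = 0 ∨ V IJ.2 = 0 := by
      intro IJ hIJ
      rcases (memDead IJ).mp hIJ with h | h | h
      · exact Or.inl h
      · rw [hW, mul_zero] at h
        exact Or.inr (mul_eq_zero.mp h.symm)
      · rw [hW, mul_zero] at h
        rcases mul_eq_zero.mp h.symm with h0 | h0
        · exact absurd h0 hc
        · exact Or.inr (mul_eq_zero.mp h0)
    by_cases hA : ∃ d₀ : Fin 3, x d₀ = 0 ∨ x d₀ ^ 2 + x (d₀ + 1) * x (d₀ + 2) = 0
    · obtain ⟨d₀, hd₀⟩ := hA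
      calc #Dead ≤ #(univ.filter fun IJ : Fin 3 × Fin 3 => IJ.2 - IJ.1 = d₀) := by
            refine Finset.card_le_card fun IJ hIJ => Finset.mem_filter.mpr ⟨Finset.mem_univ _, ?_⟩
            rcases key IJ hIJ with h | h | h
            · exact HW₁ hW h hd₀
            · exact (HW₂ hW hd₀ h).elim
            · exact (HW₃ hW hd₀ h).elim
        _ = 3 := card_filter_sub_eq d₀
        _ ≤ 4 := by norm_num
    · rw [not_exists] at hA
      by_cases hB : ∃ I₀ : Fin 3, U I₀ = 0
      · obtain ⟨I₀, hI₀⟩ := hB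
        calc #Dead ≤ #(univ.filter fun IJ : Fin 3 × Fin 3 => IJ.1 = I₀) := by
              refine Finset.card_le_card fun IJ hIJ => Finset.mem_filter.mpr ⟨Finset.mem_univ _, ?_⟩
              rcases key IJ hIJ with h | h | h
              · exact (hA _ h).elim
              · exact HW₄ hW h hI₀
              · exact (HW₆ hW hI₀ h).elim
          _ = 3 := card_filter_fst_eq I₀
          _ ≤ 4 := by norm_num
      · rw [not_exists] at hB
        by_cases hC : ∃ J₀ : Fin 3, V J₀ = 0
        · obtain ⟨J₀, hJ₀⟩ := hC
          calc #Dead ≤ #(univ.filter fun IJ : Fin 3 × Fin 3 => IJ.2 = J₀) := by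
                refine Finset.card_le_card fun IJ hIJ => Finset.mem_filter.mpr ⟨Finset.mem_univ _, ?_⟩
                rcases key IJ hIJ with h | h | h
                · exact (hA _ h).elim
                · exact (hB _ h).elim
                · exact HW₅ hW h hJ₀
            _ = 3 := card_filter_snd_eq J₀
            _ ≤ 4 := by norm_num
        · rw [not_exists] at hC
          have hempty : Dead = ∅ := by
            refine Finset.eq_empty_of_forall_notMem fun IJ hIJ => ?_
            rcases key IJ hIJ with h | h | h
            · exact hA _ h
            · exact hB _ h
            · exact hC _ h
          rw [hempty, Finset.card_empty]
          norm_num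
  · /- (B) off the line: `F = 0` -/
    have hF : x 0 ^ 3 + x 1 ^ 3 + x 2 ^ 3 + 3 * (x 0 * x 1 * x 2) = 0 := hcurve.resolve_right hW
    -- a live class has `x_d W ≠ 0`
    have hxW : ∀ d : Fin 3, ¬ (x d = 0 ∨ x d ^ 2 + x (d + 1) * x (d + 2) = 0) → x d * W ≠ 0 :=
      fun d hd => mul_ne_zero (fun h => hd (Or.inl h)) hW
    by_cases hBi : ∃ d₀ : Fin 3, x d₀ = 0 ∨ x d₀ ^ 2 + x (d₀ + 1) * x (d₀ + 2) = 0
    · /- (B-i) the class `d₀` is dead; all other classes are alive (`latin_elim`) -/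
      obtain ⟨d₀, hd₀⟩ := hBi
      have alive : ∀ d : Fin 3, d ≠ d₀ → ¬ (x d = 0 ∨ x d ^ 2 + x (d + 1) * x (d + 2) = 0) :=
        fun d hne hd => hx (latin_elim h2 x hF hne hd hd₀)
      -- a dead pair off class `d₀` has `U V ≠ 0` and `x_d W = c U V`
      have offclass : ∀ IJ ∈ Dead.filter (fun IJ : Fin 3 × Fin 3 => ¬ (IJ.2 - IJ.1 = d₀)),
          IJ.2 - IJ.1 ≠ d₀ ∧ U IJ.1 * V IJ.2 ≠ 0 ∧ x (IJ.2 - IJ.1) ≠ 0 ∧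
            x (IJ.2 - IJ.1) * W = c * (U IJ.1 * V IJ.2) := by
        intro IJ hIJ
        rw [Finset.mem_filter] at hIJ
        obtain ⟨hmem, hne⟩ := hIJ
        have hlive := alive _ hne
        have hxd : x (IJ.2 - IJ.1) ≠ 0 := fun h => hlive (Or.inl h)
        rcases (memDead IJ).mp hmem with h | h | h
        · exact (hlive h).elim
        · exact (HCQ hF hd₀ hne h).elim
        · refine ⟨hne, ?_, hxd, h⟩
          intro hUV
          rw [hUV, mul_zero] at h
          exact hxW _ hlive h
      have h1 : #(Dead.filter fun IJ : Fin 3 × Fin 3 => ¬ (IJ.2 - IJ.1 = d₀)) ≤ 1 := by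
        refine Finset.card_le_one.mpr fun P hP Q hQ => ?_
        obtain ⟨hPne, hPUV, hPx, eP⟩ := offclass P hP
        obtain ⟨hQne, hQUV, hQx, eQ⟩ := offclass Q hQ
        by_contra hPQ
        refine HCE hF hd₀ hPne hQne hPQ hPUV hQUV hPx hQx ?_
        have key : c * W * (x (P.2 - P.1) * (U Q.1 * V Q.2)) =
            c * W * (x (Q.2 - Q.1) * (U P.1 * V P.2)) := by
          linear_combination (c * (U Q.1 * V Q.2)) * eP - (c * (U P.1 * V P.2)) * eQ
        exact mul_left_cancel₀ (mul_ne_zero hc hW) key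
      have h3 : #(Dead.filter fun IJ : Fin 3 × Fin 3 => IJ.2 - IJ.1 = d₀) ≤ 3 := by
        calc #(Dead.filter fun IJ : Fin 3 × Fin 3 => IJ.2 - IJ.1 = d₀)
            ≤ #(univ.filter fun IJ : Fin 3 × Fin 3 => IJ.2 - IJ.1 = d₀) :=
              Finset.card_le_card (Finset.filter_subset_filter _ (Finset.subset_univ _))
          _ = 3 := card_filter_sub_eq d₀
      have hsplit := Finset.card_filter_add_card_filter_not
        (s := Dead) (fun IJ : Fin 3 × Fin 3 => IJ.2 - IJ.1 = d₀)
      omega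
    · /- (B-ii) every class alive: dead pairs have `μ ∈ {1, c}`, at most two of each -/
      rw [not_exists] at hBi
      have hall : ∀ d : Fin 3, x d ≠ 0 := fun d h => hBi d (Or.inl h)
      set D₁ := univ.filter fun IJ : Fin 3 × Fin 3 =>
          U IJ.1 * V IJ.2 ≠ 0 ∧ x (IJ.2 - IJ.1) * W = U IJ.1 * V IJ.2 with hD₁
      set D₂ := univ.filter fun IJ : Fin 3 × Fin 3 =>
          U IJ.1 * V IJ.2 ≠ 0 ∧ x (IJ.2 - IJ.1) * W = c * (U IJ.1 * V IJ.2) with hD₂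
      have hsub : Dead ⊆ D₁ ∪ D₂ := by
        intro IJ hIJ
        rw [Finset.mem_union, hD₁, hD₂, Finset.mem_filter, Finset.mem_filter]
        simp only [Finset.mem_univ, true_and]
        rcases (memDead IJ).mp hIJ with h | h | h
        · exact (hBi _ h).elim
        · refine Or.inl ⟨fun hUV => ?_, h⟩
          rw [hUV] at h
          exact hxW _ (hBi _) h
        · refine Or.inr ⟨fun hUV => ?_, h⟩
          rw [hUV, mul_zero] at h
          exact hxW _ (hBi _) h
      have hD₁le : #D₁ ≤ 2 := by
        by_contra hlt
        have hlt' : 2 < #D₁ := by omega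
        obtain ⟨P, Q, R, hP, hQ, hR, hPQ, hPR, hQR⟩ := Finset.two_lt_card_iff.mp hlt'
        rw [hD₁, Finset.mem_filter] at hP hQ hR
        obtain ⟨-, hPUV, eP⟩ := hP
        obtain ⟨-, hQUV, eQ⟩ := hQ
        obtain ⟨-, hRUV, eR⟩ := hR
        refine HT hF hW hall hPQ hPR hQR hPUV hQUV hRUV ?_ ?_
        · linear_combination x (Q.2 - Q.1) * eP - x (P.2 - P.1) * eQ
        · linear_combination x (R.2 - R.1) * eP - x (P.2 - P.1) * eR
      have hD₂le : #D₂ ≤ 2 := by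
        by_contra hlt
        have hlt' : 2 < #D₂ := by omega
        obtain ⟨P, Q, R, hP, hQ, hR, hPQ, hPR, hQR⟩ := Finset.two_lt_card_iff.mp hlt'
        rw [hD₂, Finset.mem_filter] at hP hQ hR
        obtain ⟨-, hPUV, eP⟩ := hP
        obtain ⟨-, hQUV, eQ⟩ := hQ
        obtain ⟨-, hRUV, eR⟩ := hR
        refine HT hF hW hall hPQ hPR hQR hPUV hQUV hRUV ?_ ?_
        · refine mul_left_cancel₀ hc ?_
          linear_combination x (Q.2 - Q.1) * eP - x (P.2 - P.1) * eQ
        · refine mul_left_cancel₀ hc ?_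
          linear_combination x (R.2 - R.1) * eP - x (P.2 - P.1) * eR
      calc #Dead ≤ #(D₁ ∪ D₂) := Finset.card_le_card hsub
        _ ≤ #D₁ + #D₂ := Finset.card_union_le _ _
        _ ≤ 4 := by omega

end Count

/-! ### The interface form for the bordered Latin plane -/

section Border

variable {K : Type*} [Field K] [DecidableEq K]

/-- **At most four of the nine core block values die modulo `p` (BorderInterfaces.md §2).**  For a field `K`
with `m ≠ 0` in `K` for `0 < m < 3·10¹⁴`, the bordered Latin design of `…BorderDefs` (column forms
`u_I = aeval x (bordEnt ℤ (some I) none)`, row forms `v_J = aeval x (bordEnt ℤ none (some J))`, corner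
`w = aeval x (bordEnt ℤ none none)`), `c ≠ 0`, and a point `x ≠ 0` with `F(x) = 0 ∨ w(x) = 0`: assuming the
field-level non-degeneracy statements (HW), (HC), (HT) of BorderInterfaces.md §1 (hypotheses here; the lead's
`…BorderCert*` files prove them for this design), at most four pairs `(I, J)` satisfy
`classDead (J-I) ∨ x_{J-I} w = u_I v_J ∨ x_{J-I} w = c u_I v_J`. [folklore] -/
theorem bord_deaths_le_four
    (hK : ∀ m : ℕ, 0 < m → m < 300000000000000 → (m : K) ≠ 0)
    (HW₁ : ∀ x : Fin 3 → K, x ≠ 0 → aeval x (bordEnt ℤ none none) = 0 → ∀ {d d' : Fin 3},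
      (x d = 0 ∨ x d ^ 2 + x (d + 1) * x (d + 2) = 0) →
      (x d' = 0 ∨ x d' ^ 2 + x (d' + 1) * x (d' + 2) = 0) → d = d')
    (HW₂ : ∀ x : Fin 3 → K, x ≠ 0 → aeval x (bordEnt ℤ none none) = 0 → ∀ {d I : Fin 3},
      (x d = 0 ∨ x d ^ 2 + x (d + 1) * x (d + 2) = 0) → aeval x (bordEnt ℤ (some I) none) = 0 → False)
    (HW₃ : ∀ x : Fin 3 → K, x ≠ 0 → aeval x (bordEnt ℤ none none) = 0 → ∀ {d J : Fin 3},
      (x d = 0 ∨ x d ^ 2 + x (d + 1) * x (d + 2) = 0) → aeval x (bordEnt ℤ none (some J)) = 0 → False)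
    (HW₄ : ∀ x : Fin 3 → K, x ≠ 0 → aeval x (bordEnt ℤ none none) = 0 → ∀ {I I' : Fin 3},
      aeval x (bordEnt ℤ (some I) none) = 0 → aeval x (bordEnt ℤ (some I') none) = 0 → I = I')
    (HW₅ : ∀ x : Fin 3 → K, x ≠ 0 → aeval x (bordEnt ℤ none none) = 0 → ∀ {J J' : Fin 3},
      aeval x (bordEnt ℤ none (some J)) = 0 → aeval x (bordEnt ℤ none (some J')) = 0 → J = J')
    (HW₆ : ∀ x : Fin 3 → K, x ≠ 0 → aeval x (bordEnt ℤ none none) = 0 → ∀ {I J : Fin 3},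
      aeval x (bordEnt ℤ (some I) none) = 0 → aeval x (bordEnt ℤ none (some J)) = 0 → False)
    (HCQ : ∀ x : Fin 3 → K, x ≠ 0 → x 0 ^ 3 + x 1 ^ 3 + x 2 ^ 3 + 3 * (x 0 * x 1 * x 2) = 0 →
      ∀ {d₀ : Fin 3}, (x d₀ = 0 ∨ x d₀ ^ 2 + x (d₀ + 1) * x (d₀ + 2) = 0) → ∀ {I J : Fin 3}, J - I ≠ d₀ →
      x (J - I) * aeval x (bordEnt ℤ none none) ≠
        aeval x (bordEnt ℤ (some I) none) * aeval x (bordEnt ℤ none (some J)))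
    (HCE : ∀ x : Fin 3 → K, x ≠ 0 → x 0 ^ 3 + x 1 ^ 3 + x 2 ^ 3 + 3 * (x 0 * x 1 * x 2) = 0 →
      ∀ {d₀ : Fin 3}, (x d₀ = 0 ∨ x d₀ ^ 2 + x (d₀ + 1) * x (d₀ + 2) = 0) → ∀ {I J I' J' : Fin 3},
      J - I ≠ d₀ → J' - I' ≠ d₀ → (I, J) ≠ (I', J') →
      aeval x (bordEnt ℤ (some I) none) * aeval x (bordEnt ℤ none (some J)) ≠ 0 →
      aeval x (bordEnt ℤ (some I') none) * aeval x (bordEnt ℤ none (some J')) ≠ 0 →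
      x (J - I) ≠ 0 → x (J' - I') ≠ 0 →
      x (J - I) * (aeval x (bordEnt ℤ (some I') none) * aeval x (bordEnt ℤ none (some J'))) ≠
        x (J' - I') * (aeval x (bordEnt ℤ (some I) none) * aeval x (bordEnt ℤ none (some J))))
    (HT : ∀ x : Fin 3 → K, x ≠ 0 → x 0 ^ 3 + x 1 ^ 3 + x 2 ^ 3 + 3 * (x 0 * x 1 * x 2) = 0 →
      aeval x (bordEnt ℤ none none) ≠ 0 → (∀ d, x d ≠ 0) →
      ∀ {I₁ J₁ I₂ J₂ I₃ J₃ : Fin 3}, (I₁, J₁) ≠ (I₂, J₂) → (I₁, J₁) ≠ (I₃, J₃) → (I₂, J₂) ≠ (I₃, J₃) →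
      aeval x (bordEnt ℤ (some I₁) none) * aeval x (bordEnt ℤ none (some J₁)) ≠ 0 →
      aeval x (bordEnt ℤ (some I₂) none) * aeval x (bordEnt ℤ none (some J₂)) ≠ 0 →
      aeval x (bordEnt ℤ (some I₃) none) * aeval x (bordEnt ℤ none (some J₃)) ≠ 0 →
      x (J₁ - I₁) * (aeval x (bordEnt ℤ (some I₂) none) * aeval x (bordEnt ℤ none (some J₂))) =
        x (J₂ - I₂) * (aeval x (bordEnt ℤ (some I₁) none) * aeval x (bordEnt ℤ none (some J₁))) →
      x (J₁ - I₁) * (aeval x (bordEnt ℤ (some I₃) none) * aeval x (bordEnt ℤ none (some J₃))) =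
        x (J₃ - I₃) * (aeval x (bordEnt ℤ (some I₁) none) * aeval x (bordEnt ℤ none (some J₁))) →
      False)
    (c : K) (hc : c ≠ 0) (x : Fin 3 → K) (hx : x ≠ 0)
    (hcurve : x 0 ^ 3 + x 1 ^ 3 + x 2 ^ 3 + 3 * (x 0 * x 1 * x 2) = 0 ∨
      aeval x (bordEnt ℤ none none) = 0) :
    #(univ.filter fun IJ : Fin 3 × Fin 3 =>
        (x (IJ.2 - IJ.1) = 0 ∨ x (IJ.2 - IJ.1) ^ 2 + x (IJ.2 - IJ.1 + 1) * x (IJ.2 - IJ.1 + 2) = 0) ∨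
        x (IJ.2 - IJ.1) * aeval x (bordEnt ℤ none none) =
          aeval x (bordEnt ℤ (some IJ.1) none) * aeval x (bordEnt ℤ none (some IJ.2)) ∨
        x (IJ.2 - IJ.1) * aeval x (bordEnt ℤ none none) =
          c * (aeval x (bordEnt ℤ (some IJ.1) none) * aeval x (bordEnt ℤ none (some IJ.2)))) ≤ 4 := by
  have h2 : (2 : K) ≠ 0 := by exact_mod_cast hK 2 (by norm_num) (by norm_num)
  exact deaths_le_four_of_hyp x (fun I => aeval x (bordEnt ℤ (some I) none))
    (fun J => aeval x (bordEnt ℤ none (some J))) (aeval x (bordEnt ℤ none none)) c hc h2 hx hcurve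
    (HW₁ x hx) (HW₂ x hx) (HW₃ x hx) (HW₄ x hx) (HW₅ x hx) (HW₆ x hx) (HCQ x hx) (HCE x hx) (HT x hx)

end Border

end Summit.ValiantsHypothesis.ValiantsHypothesis.Theorems.GrenetZeonHessianRankCodimTwo
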